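import Mathlib.Analysis.SpecialFunctions.Pow.Real
import Mathlib.Analysis.Complex.Polynomial.Basic
import Mathlib.FieldTheory.IsAlgClosed.Spectrum
import Mathlib.LinearAlgebra.Eigenspace.Basic
import Literature.NumberTheory.EllipticCurves.DeligneHeckeEigenvalueBound
import Literature.NumberTheory.EllipticCurves.ModularCurveSturmProofs
import HarnessLib

/-!
# Eisenstein and cuspidal Hecke eigenvalues at an auxiliary prime are separated by Deligne's bound

Sorry-free, THEOREMS ONLY (no definition, no named fact). Companion to
`Literature/LinearAlgebra/EigenvalueSeparatingAnnihilator.lean` (the vector-space quasi-projector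
`Θ₀ = ∏_{a ∈ 𝒜} (T_ℓ - a)^n`, which ASSUMES that no `a ∈ 𝒜` is an eigenvalue of `T_ℓ` on the cuspidal piece)
and to `Literature/Algebra/Module/EndomorphismVanishingOfDisjointSupport.lean` (which ASSUMES that the
`Λ`-adic Eisenstein and cuspidal Hecke eigensystems have disjoint supports): this file kernel-checks the ONE
archimedean inequality both assumptions rest on, and discharges the first one on `S_k(Γ₀(N))` from the tree's
named fact `Deligne1974_heckeT_eigenvalue_norm_le` (Deligne, Weil I, Thm. 8.2).

THE INEQUALITY (reader 2 of cell `bsd-litref/cgs25`, `D-AUDIT-cgs25-r2-ADDENDUM-9.md` sha16 2fb9c8cd650df85a,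
§2 precision P1; re-derived by referee C4 at ROUND C4-R5-ADD-3 (β), `pub-bsdpct/REFEREE.md`). In weight
`k = n + 1 ≥ 2` and at a prime `ℓ` away from the level, an Eisenstein eigenform has `T_ℓ`-eigenvalue
`ψ(ℓ) + φ(ℓ) ℓ^{k-1}` with Dirichlet characters `ψ, φ` (Diamond–Shurman Prop. 5.2.3
[corpus book:diamond2005-first-course-modular-forms p0193:L11]), of absolute value `≥ ℓ^{k-1} - 1` (reverse
triangle inequality on unit-modulus character values), while a cuspidal eigenvalue `a` has `|a| ≤ 2 ℓ^{(k-1)/2}`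
(Deligne). With `y := ℓ^{k-1}` the two ranges are DISJOINT as soon as `2√y < y - 1`, i.e. `y > 3 + 2√2 ≈ 5.83`,
i.e. (for integral `y`) `y ≥ 6`: so `ℓ ≥ 7` works in EVERY weight `≥ 2` (`ℓ = 6` is not prime), `ℓ ≥ 3` in
weight `≥ 3`, every prime in weight `≥ 4`; and the triangle-inequality argument genuinely FAILS at `ℓ = 5` in
weight `2` (`2√5 > 5 - 1`), which is why ADD-9 P1's threshold `ℓ ≥ 7` supersedes ADD-8 (3.3)(iii).

* §1 `two_mul_sqrt_lt_sub_one` — `6 ≤ y ⇒ 2√y < y - 1`; `sub_one_lt_two_mul_sqrt_five` — the failure at `y = 5`;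
  `six_le_pow_*` — the integral thresholds (`ℓ ≥ 6, n ≥ 1` / `ℓ ≥ 3, n ≥ 2` / `ℓ ≥ 2, n ≥ 3`).
* §2 `sub_one_le_norm_add_mul` — `‖ζ₁‖ ≤ 1`, `‖ζ₂‖ = 1`, `0 ≤ y` ⇒ `y - 1 ≤ ‖ζ₁ + ζ₂ y‖`;
  `ne_add_mul_of_norm_le_two_mul_sqrt` — with `6 ≤ y` and `‖a‖ ≤ 2√y`: `a ≠ ζ₁ + ζ₂ y` (the SEPARATION);
  `ne_add_mul_pow_of_norm_le_rpow` — the same in Deligne's normalisation `‖a‖ ≤ 2 ℓ^{n/2}`, `y = ℓ^n`.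
* §3 On `S_{n+1}(Γ₀(N))`, granted `Deligne1974_heckeT_eigenvalue_norm_le` (`hDel`): for `ℓ ∤ N` prime with
  `6 ≤ ℓ^n`, NO number `ζ₁ + ζ₂ ℓ^n` (`‖ζ₁‖ ≤ 1`, `‖ζ₂‖ = 1`) is an eigenvalue of `T_ℓ = heckeT (Γ₀(N)) (n+1) ℓ`
  (`not_hasEigenvalue_heckeT_eisensteinValue`); hence `T_ℓ - (ζ₁ + ζ₂ ℓ^n)` is a unit of `End(S_{n+1}(Γ₀(N)))`
  (`isUnit_heckeT_sub_eisensteinValue`) and so is reader 2's `Θ₀ = ∏_{a ∈ 𝒜} (T_ℓ - a)^m` for any finite set `𝒜`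
  of such Eisenstein values (`isUnit_aeval_prod_X_sub_C_pow_heckeT`) — the classical-point form of ADD-9 §2 (iii)
  at trivial nebentypus (`⟨ℓ⟩ = 1`, so `T′_ℓ = ⟨ℓ⟩⁻¹ T_ℓ = T_ℓ`). `S_k(Γ₀(N))` is finite-dimensional by the tree's
  PROVED Sturm bound (`finiteDimensional_cuspForm_gamma0`), so eigenvalues = spectrum and the spectral mapping
  theorem for polynomials applies (`isUnit_aeval_of_forall_hasEigenvalue_eval_ne_zero`, any finite-dimensional
  complex `T`).

What is NOT here: Deligne's bound itself (the named fact, threaded as a hypothesis — D-0026: no new fact), the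
Eisenstein eigenvalue computation (Diamond–Shurman Prop. 5.2.3, cited for the SHAPE `ψ(ℓ) + φ(ℓ)ℓ^{k-1}` only;
the theorems below quantify over all `ζ₁, ζ₂` of modulus `≤ 1`, `= 1`), forms with nebentypus / level `Γ₁(N)`
(the tree's Deligne fact is stated on `Γ₀(N)`; §§1–2 are level-free) — TODO(general form): `S_k(Γ₁(N))` once a
`Γ₁` Deligne fact exists — and anything `Λ`-adic (the readers' `Θ = δ′δ″Θ₀` lives on Hida's `M^ord`; its
module algebra is `EndomorphismVanishingOfDisjointSupport` §5 / `EigenvalueSeparatingAnnihilator`). The cell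
grades the L-η assembly in which P1 sits PASS-in-cell(assembly) (C4-R5-ADD-3); this file is a kernel check of
its arithmetic, nothing more. References: Deligne, Publ. Math. IHÉS 43 (1974) Thm. 8.2; Diamond–Shurman, GTM 228
(2005) Prop. 5.2.3; Murty–Sinha, JNT 129 (2009) §1 (the `S_k(Γ₀(N))` form of Deligne's bound, as in the fact).
-/

noncomputable section

open scoped MatrixGroups ModularForm

open CongruenceSubgroup Polynomial

namespace Literature.NumberTheory.ModularForms.EisensteinCuspidalSeparation

open Literature.NumberTheory.EllipticCurves.ModularForms

/-! ## §1 The real inequality `2√y < y - 1` for `y ≥ 6`, its failure at `y = 5`, and the integral thresholds -/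

/-- **P1's inequality.** For real `y ≥ 6`: `2√y < y - 1`. (Equivalently `y > 3 + 2√2`; `√y ≥ √6 > 61/25 > 1 + √2`
and `s² - 2s - 1 = (s - 61/25)(s + 11/25) + 46/625`.) With `y = ℓ^{k-1}` this is «Deligne's bound `2ℓ^{(k-1)/2}` is
smaller than the Eisenstein lower bound `ℓ^{k-1} - 1`».
[cite: Deligne1974, Thm. 8.2 (the bound whose range this separates; inequality = cgs25-r2 ADDENDUM-9 §2 P1, referee C4 ROUND C4-R5-ADD-3 (β), in-cell)] -/
theorem two_mul_sqrt_lt_sub_one {y : ℝ} (hy : 6 ≤ y) : 2 * Real.sqrt y < y - 1 := by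
  have hy0 : 0 ≤ y := by linarith
  have hs : Real.sqrt y ^ 2 = y := Real.sq_sqrt hy0
  have hs0 : 0 ≤ Real.sqrt y := Real.sqrt_nonneg y
  have h61 : (61 / 25 : ℝ) ≤ Real.sqrt y := by
    rw [Real.le_sqrt (by norm_num) hy0]
    nlinarith
  nlinarith [mul_nonneg (sub_nonneg.mpr h61) (show (0 : ℝ) ≤ Real.sqrt y + 11 / 25 by linarith)]

/-- **The threshold is real: failure at `y = 5`** (weight `2`, `ℓ = 5`): `5 - 1 < 2√5`, so the reverse-triangle
lower bound `ℓ - 1` does NOT beat Deligne's `2√ℓ` at `ℓ = 5` — ADD-9 P1's `ℓ ≥ 7` supersedes ADD-8 (3.3)(iii).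
[cite: Deligne1974, Thm. 8.2 (range comparison at ℓ = 5, k = 2; referee C4 ROUND C4-R5-ADD-3 (β): «(2√5)² = 20 > 16»)] -/
theorem sub_one_lt_two_mul_sqrt_five : (5 : ℝ) - 1 < 2 * Real.sqrt 5 := by
  have h2 : (2 : ℝ) < Real.sqrt 5 := by
    rw [Real.lt_sqrt (by norm_num)]
    norm_num
  linarith

/-- Integral threshold, weight `2` and up: `ℓ ≥ 6` and `n ≥ 1` give `6 ≤ ℓ^n` (so every prime `ℓ ≥ 7` works in
every weight `k = n + 1 ≥ 2`). [cite: Deligne1974, Thm. 8.2 (threshold bookkeeping for the separation; cgs25-r2 ADDENDUM-9 P1 «ℓ ≥ 7»)] -/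
theorem six_le_pow_of_six_le {ℓ n : ℕ} (hℓ : 6 ≤ ℓ) (hn : 1 ≤ n) : 6 ≤ ℓ ^ n :=
  calc 6 ≤ ℓ := hℓ
    _ = ℓ ^ 1 := (pow_one ℓ).symm
    _ ≤ ℓ ^ n := Nat.pow_le_pow_right (by omega) hn

/-- Integral threshold, weight `3` and up: `ℓ ≥ 3` and `n ≥ 2` give `6 ≤ ℓ^n`.
[cite: Deligne1974, Thm. 8.2 (threshold bookkeeping for the separation)] -/
theorem six_le_pow_of_three_le {ℓ n : ℕ} (hℓ : 3 ≤ ℓ) (hn : 2 ≤ n) : 6 ≤ ℓ ^ n :=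
  calc 6 ≤ 3 ^ 2 := by norm_num
    _ ≤ ℓ ^ 2 := Nat.pow_le_pow_left hℓ 2
    _ ≤ ℓ ^ n := Nat.pow_le_pow_right (by omega) hn

/-- Integral threshold, weight `4` and up: `ℓ ≥ 2` and `n ≥ 3` give `6 ≤ ℓ^n` (every prime works).
[cite: Deligne1974, Thm. 8.2 (threshold bookkeeping for the separation)] -/
theorem six_le_pow_of_two_le {ℓ n : ℕ} (hℓ : 2 ≤ ℓ) (hn : 3 ≤ n) : 6 ≤ ℓ ^ n :=
  calc 6 ≤ 2 ^ 3 := by norm_num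
    _ ≤ ℓ ^ 3 := Nat.pow_le_pow_left hℓ 3
    _ ≤ ℓ ^ n := Nat.pow_le_pow_right (by omega) hn

/-! ## §2 The Eisenstein lower bound and the separation -/

/-- **Eisenstein lower bound** (reverse triangle inequality on character values): for `ζ₁, ζ₂ ∈ ℂ` with
`‖ζ₁‖ ≤ 1`, `‖ζ₂‖ = 1` and real `y ≥ 0`, `y - 1 ≤ ‖ζ₁ + ζ₂·y‖`. (With `ζ₁ = ψ(ℓ)`, `ζ₂ = φ(ℓ)`, `y = ℓ^{k-1}` this
is `|ψ(ℓ) + φ(ℓ)ℓ^{k-1}| ≥ ℓ^{k-1} - 1` for the `T_ℓ`-eigenvalue of `E_k^{ψ,φ,t}`, Diamond–Shurman Prop. 5.2.3.)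
[cite: DiamondShurman2005, Prop. 5.2.3 (corpus book:diamond2005-first-course-modular-forms p0193:L11; eigenvalue shape only)] -/
theorem sub_one_le_norm_add_mul {ζ₁ ζ₂ : ℂ} {y : ℝ} (h₁ : ‖ζ₁‖ ≤ 1) (h₂ : ‖ζ₂‖ = 1) (hy : 0 ≤ y) :
    y - 1 ≤ ‖ζ₁ + ζ₂ * (y : ℂ)‖ := by
  have hn : ‖ζ₂ * (y : ℂ)‖ = y := by
    rw [norm_mul, h₂, one_mul, Complex.norm_of_nonneg hy]
  have h := norm_le_add_norm_add' ζ₁ (ζ₂ * (y : ℂ))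
  rw [hn] at h
  linarith

/-- **Eisenstein values exceed Deligne's bound**: `6 ≤ y`, `‖ζ₁‖ ≤ 1`, `‖ζ₂‖ = 1` ⇒ `2√y < ‖ζ₁ + ζ₂·y‖`.
[cite: Deligne1974, Thm. 8.2 (range comparison; cgs25-r2 ADDENDUM-9 §2 P1, referee C4 C4-R5-ADD-3 (β))] -/
theorem two_mul_sqrt_lt_norm_add_mul {ζ₁ ζ₂ : ℂ} {y : ℝ} (hy : 6 ≤ y) (h₁ : ‖ζ₁‖ ≤ 1) (h₂ : ‖ζ₂‖ = 1) :
    2 * Real.sqrt y < ‖ζ₁ + ζ₂ * (y : ℂ)‖ :=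
  (two_mul_sqrt_lt_sub_one hy).trans_le (sub_one_le_norm_add_mul h₁ h₂ (by linarith))

/-- **THE SEPARATION.** If `6 ≤ y`, `‖a‖ ≤ 2√y` (a cuspidal `T_ℓ`-eigenvalue under Deligne's bound, `y = ℓ^{k-1}`)
and `‖ζ₁‖ ≤ 1`, `‖ζ₂‖ = 1` (character values), then `a ≠ ζ₁ + ζ₂·y` (an Eisenstein `T_ℓ`-eigenvalue).
[cite: Deligne1974, Thm. 8.2] [cite: DiamondShurman2005, Prop. 5.2.3 (eigenvalue shape; separation = cgs25-r2 ADDENDUM-9 §2 P1, in-cell)] -/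
theorem ne_add_mul_of_norm_le_two_mul_sqrt {a ζ₁ ζ₂ : ℂ} {y : ℝ} (hy : 6 ≤ y)
    (ha : ‖a‖ ≤ 2 * Real.sqrt y) (h₁ : ‖ζ₁‖ ≤ 1) (h₂ : ‖ζ₂‖ = 1) : a ≠ ζ₁ + ζ₂ * (y : ℂ) := by
  intro h
  have hlt := two_mul_sqrt_lt_norm_add_mul hy h₁ h₂
  rw [← h] at hlt
  exact absurd ha (not_le.mpr hlt)

/-- Deligne's exponent: `ℓ^{n/2} = √(ℓ^n)` for `ℓ ≥ 0` (real powers).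
[cite: Deligne1974, Thm. 8.2 (normalisation `2 p^{(k-1)/2}` of the bound)] -/
theorem rpow_div_two_eq_sqrt_pow {x : ℝ} (hx : 0 ≤ x) (n : ℕ) :
    x ^ ((n : ℝ) / 2) = Real.sqrt (x ^ n) := by
  rw [Real.sqrt_eq_rpow, ← Real.rpow_natCast, ← Real.rpow_mul hx, mul_one_div]

/-- **The separation in Deligne's normalisation**: `ℓ, n ∈ ℕ` with `6 ≤ ℓ^n`, `‖a‖ ≤ 2·ℓ^{n/2}`, `‖ζ₁‖ ≤ 1`,
`‖ζ₂‖ = 1` ⇒ `a ≠ ζ₁ + ζ₂·ℓ^n`. (Weight `k = n + 1`; `ℓ ≥ 7` suffices for all `n ≥ 1`, `six_le_pow_of_six_le`.)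
[cite: Deligne1974, Thm. 8.2] [cite: DiamondShurman2005, Prop. 5.2.3 (eigenvalue shape; separation = cgs25-r2 ADDENDUM-9 §2 P1, in-cell)] -/
theorem ne_add_mul_pow_of_norm_le_rpow {ℓ n : ℕ} (h6 : 6 ≤ ℓ ^ n) {a ζ₁ ζ₂ : ℂ}
    (ha : ‖a‖ ≤ 2 * (ℓ : ℝ) ^ ((n : ℝ) / 2)) (h₁ : ‖ζ₁‖ ≤ 1) (h₂ : ‖ζ₂‖ = 1) :
    a ≠ ζ₁ + ζ₂ * (ℓ : ℂ) ^ n := by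
  have hy : (6 : ℝ) ≤ ((ℓ : ℝ) ^ n) := by exact_mod_cast h6
  rw [rpow_div_two_eq_sqrt_pow (Nat.cast_nonneg ℓ) n] at ha
  have h := ne_add_mul_of_norm_le_two_mul_sqrt hy ha h₁ h₂
  push_cast at h
  exact h

/-! ## §3 On `S_k(Γ₀(N))`: no Eisenstein value is a `T_ℓ`-eigenvalue, and `Θ₀` is invertible (granted Deligne) -/

section Gamma0

variable (N : ℕ) [NeZero N]

/-- **No Eisenstein value is a cuspidal `T_ℓ`-eigenvalue on `S_{n+1}(Γ₀(N))`** (granted Deligne's bound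
`Deligne1974_heckeT_eigenvalue_norm_le`): for `ℓ ∤ N` prime with `6 ≤ ℓ^n` and any `ζ₁, ζ₂` with `‖ζ₁‖ ≤ 1`,
`‖ζ₂‖ = 1`, the number `ζ₁ + ζ₂·ℓ^n` is not an eigenvalue of `T_ℓ = heckeT (Γ₀(N)) (n+1) ℓ`.
[cite: Deligne1974, Thm. 8.2] [cite: MurtySinha2009, §1 (p. 681; the S_k(Γ₀(N)) form of the bound)] [cite: DiamondShurman2005, Prop. 5.2.3 (eigenvalue shape; separation = cgs25-r2 ADDENDUM-9 §2 P1, in-cell)] -/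
theorem not_hasEigenvalue_heckeT_eisensteinValue (hDel : Deligne1974_heckeT_eigenvalue_norm_le)
    (n : ℕ) (hn : 1 ≤ n) (ℓ : ℕ) [NeZero ℓ] (hℓ : ℓ.Prime) (hℓN : ¬ ℓ ∣ N) (h6 : 6 ≤ ℓ ^ n)
    (ζ₁ ζ₂ : ℂ) (h₁ : ‖ζ₁‖ ≤ 1) (h₂ : ‖ζ₂‖ = 1) :
    ¬ Module.End.HasEigenvalue (heckeT (Gamma0 N) ((n : ℤ) + 1) ℓ) (ζ₁ + ζ₂ * (ℓ : ℂ) ^ n) := by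
  intro hev
  have hb := hDel N ((n : ℤ) + 1) (by omega) ℓ hℓ hℓN _ hev
  have he : (((((n : ℤ) + 1 : ℤ) : ℝ)) - 1) / 2 = (n : ℝ) / 2 := by push_cast; ring
  rw [he] at hb
  exact ne_add_mul_pow_of_norm_le_rpow h6 hb h₁ h₂ rfl

/-- In a finite-dimensional complex vector space, a polynomial in `T` whose value at every eigenvalue of `T` is
non-zero is a UNIT of `End(V)` (spectral mapping theorem for polynomials; eigenvalues = spectrum).
[cite: Deligne1974, Thm. 8.2 (linear-algebra step of the application below; folklore spectral mapping)] -/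
theorem isUnit_aeval_of_forall_hasEigenvalue_eval_ne_zero {V : Type*} [AddCommGroup V] [Module ℂ V]
    [FiniteDimensional ℂ V] (T : Module.End ℂ V) (p : ℂ[X]) (hp : p ≠ 0)
    (h : ∀ μ : ℂ, T.HasEigenvalue μ → p.eval μ ≠ 0) : IsUnit (aeval T p) := by
  by_cases hdeg : 0 < p.degree
  · rw [← spectrum.zero_notMem_iff ℂ, spectrum.map_polynomial_aeval_of_degree_pos T p hdeg]
    rintro ⟨μ, hμ, h0⟩
    exact h μ (Module.End.hasEigenvalue_iff_mem_spectrum.mpr hμ) h0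
  · have hp0 : p = C (p.coeff 0) := eq_C_of_degree_le_zero (not_lt.mp hdeg)
    have hc : p.coeff 0 ≠ 0 := by
      intro hc
      rw [hc, map_zero] at hp0
      exact hp hp0
    rw [hp0, aeval_C]
    exact (Ne.isUnit hc).map (algebraMap ℂ (Module.End ℂ V))

/-- **`T_ℓ - (ζ₁ + ζ₂ℓ^n)` is invertible on `S_{n+1}(Γ₀(N))`** (granted Deligne's bound; `ℓ ∤ N` prime,
`6 ≤ ℓ^n`, `‖ζ₁‖ ≤ 1`, `‖ζ₂‖ = 1`); finite-dimensionality of `S_k(Γ₀(N))` is the tree's PROVED Sturm bound.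
[cite: Deligne1974, Thm. 8.2] [cite: MurtySinha2009, §1 (p. 681)] [cite: DiamondShurman2005, Prop. 5.2.3 (eigenvalue shape; application = cgs25-r2 ADDENDUM-9 §2 (iii) at a classical point, in-cell)] -/
theorem isUnit_heckeT_sub_eisensteinValue (hDel : Deligne1974_heckeT_eigenvalue_norm_le)
    (n : ℕ) (hn : 1 ≤ n) (ℓ : ℕ) [NeZero ℓ] (hℓ : ℓ.Prime) (hℓN : ¬ ℓ ∣ N) (h6 : 6 ≤ ℓ ^ n)
    (ζ₁ ζ₂ : ℂ) (h₁ : ‖ζ₁‖ ≤ 1) (h₂ : ‖ζ₂‖ = 1) :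
    IsUnit (heckeT (Gamma0 N) ((n : ℤ) + 1) ℓ -
      algebraMap ℂ (Module.End ℂ (CuspForm (Gamma0 N) ((n : ℤ) + 1))) (ζ₁ + ζ₂ * (ℓ : ℂ) ^ n)) := by
  haveI := finiteDimensional_cuspForm_gamma0 N ((n : ℤ) + 1)
  have h := isUnit_aeval_of_forall_hasEigenvalue_eval_ne_zero (heckeT (Gamma0 N) ((n : ℤ) + 1) ℓ)
    (X - C (ζ₁ + ζ₂ * (ℓ : ℂ) ^ n)) (X_sub_C_ne_zero _) (fun μ hμ ↦ by
      rw [eval_sub, eval_X, eval_C, sub_ne_zero]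
      rintro rfl
      exact not_hasEigenvalue_heckeT_eisensteinValue N hDel n hn ℓ hℓ hℓN h6 ζ₁ ζ₂ h₁ h₂ hμ)
  simpa [aeval_X, aeval_C] using h

/-- **Reader 2's `Θ₀` is invertible on `S_{n+1}(Γ₀(N))`** (granted Deligne's bound): for a finite set `𝒜 ⊂ ℂ`
of Eisenstein values at `ℓ` (each `a = ζ₁ + ζ₂ℓ^n` with `‖ζ₁‖ ≤ 1`, `‖ζ₂‖ = 1`), `ℓ ∤ N` prime, `6 ≤ ℓ^n`, and
any exponent `m`, the operator `Θ₀ = ∏_{a ∈ 𝒜} (T_ℓ - a)^m` is a unit of `End(S_{n+1}(Γ₀(N)))` — the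
classical-point, trivial-nebentypus form of cgs25-r2 ADDENDUM-9 §2 (iii) («`Θ₀` acts invertibly on each cuspidal
eigen-piece»); the hypothesis «no `a_i` is an eigenvalue on `V₁`» of
`Literature.LinearAlgebra.quasiProjector_of_prod_linear_factors` is thereby DISCHARGED from Deligne's fact here.
[cite: Deligne1974, Thm. 8.2] [cite: MurtySinha2009, §1 (p. 681)] [cite: DiamondShurman2005, Prop. 5.2.3 (eigenvalue shape; application = cgs25-r2 ADDENDUM-9 §2 P1/(iii), referee C4 C4-R5-ADD-3 (β), in-cell)] -/
theorem isUnit_aeval_prod_X_sub_C_pow_heckeT (hDel : Deligne1974_heckeT_eigenvalue_norm_le)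
    (n : ℕ) (hn : 1 ≤ n) (ℓ : ℕ) [NeZero ℓ] (hℓ : ℓ.Prime) (hℓN : ¬ ℓ ∣ N) (h6 : 6 ≤ ℓ ^ n)
    (𝒜 : Finset ℂ) (h𝒜 : ∀ a ∈ 𝒜, ∃ ζ₁ ζ₂ : ℂ, ‖ζ₁‖ ≤ 1 ∧ ‖ζ₂‖ = 1 ∧ a = ζ₁ + ζ₂ * (ℓ : ℂ) ^ n) (m : ℕ) :
    IsUnit (aeval (heckeT (Gamma0 N) ((n : ℤ) + 1) ℓ) (∏ a ∈ 𝒜, (X - C a) ^ m)) := by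
  haveI := finiteDimensional_cuspForm_gamma0 N ((n : ℤ) + 1)
  refine isUnit_aeval_of_forall_hasEigenvalue_eval_ne_zero _ _
    (Monic.ne_zero (monic_prod_of_monic _ _ fun a _ ↦ (monic_X_sub_C a).pow m)) fun μ hμ ↦ ?_
  rw [eval_prod, Finset.prod_ne_zero_iff]
  intro a ha
  rw [eval_pow, eval_sub, eval_X, eval_C]
  refine pow_ne_zero _ (sub_ne_zero.mpr ?_)
  obtain ⟨ζ₁, ζ₂, h₁, h₂, rfl⟩ := h𝒜 a ha
  rintro rfl
  exact not_hasEigenvalue_heckeT_eisensteinValue N hDel n hn ℓ hℓ hℓN h6 ζ₁ ζ₂ h₁ h₂ hμ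

end Gamma0

end Literature.NumberTheory.ModularForms.EisensteinCuspidalSeparation

end
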